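/-
Copyright (c) 2026 the pub-hodgecm-mathlib formalisation cell (harness21).  Prover seat hodgecm-mathlib-LH5-p04 (g9); G-rows dealer ∕ reader F0P3a-p09 (g13) (LEAD F0P3a-plan
T14-67 rule 20 ∕ T14-69 (1)); G-ROW LEDGER v4 row «(G3)-RAM-TAME» (first-in-line 23:24:09Z, trigger (G3) ★ 23:5xZ); the tame-ramified twin of ★ (G3) `F0P3cStCharTSEPGlueG`
(LH10-p02 (g12)), re-lettered over ★ EULER-G-RAM (p852968), ★ P2-RAM (p852982) ∕ ★ C₃-RAM (P3 ED. 2, F0P2-p02), ★ (T2)-RAM (F0P2-p02), ★ (G0)-RAM (LH1-p01); 2026-09-03.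
-/
import Summits.HodgeConjecture.HodgeConjecture.Theorems.F0P3cStCharTSEPGlueG              -- ★ (G3) (LH10-p02): brings ★ GLUE, ★ P3 (+ ED. 2 C₃-RAM), ★ (T2) (+ ED. 2), ★ (G0) (+ ED. 2 RAM indices), ★ (G7), the CM one-place kit
import HarnessLib

/-!
# F0 · P3c · line LH6 «StCharTS» — «(G3)-RAM», FILE A (core): the (T1) and (N) inputs of Kottwitz's Euler–Poincaré function on `U(Φ₃)(L⁺_v)` at a TAMELY RAMIFIED place
# [Kottwitz1988 §2 Thm. 2; Rogawski1990 §12.6; Tits1979 §2.4 (the ramified quasi-split `²A₂`: local index `(q+1, q+1)`)]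

Cell `pub/hodgecm-mathlib`, crux H413 = `stmt-HodgeConjecture-24833` (lane `--kind proof --supports … --as helper`), route HCCMUnconditional; seat LH5-p04 (g9), «(G3)-RAM-TAME»
first-in-line by the G-row dealer F0P3a-p09 (g13) (23:24:09Z ∕ 23:31:58Z ∕ 23:49:26Z: (a) (T1)-RAM + (c) sign + (d) CM (N)-RAM head INSIDE this file; (b) indices = ★ LH1-p01's
`index_inf_subgroupOf_eq_of_ramified`).  THEOREMS ONLY (no definition ∕ instance ∕ notation ∕ named fact ∕ `sorry`); ★-only imports.

WHAT.  The tame-ramified twin of ★ (G3) `F0P3cStCharTSEPGlueG.exists_epFunction_G`: for a CM field `L`, a finite place `v` of `L⁺` that is non-split AND RAMIFIED in `L`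
(`w ∣ v`, `e(w|v) ≠ 1`) of ODD residue characteristic (`|2|_w = 1`), every Haar measure `νQv` on `G_v = U(Φ₃)(L⁺_v)` and every family `mQv` canonical for (`IsRegularElt`, `νQv`),
there is `f_G ∈ C_c^∞(G_v)` — `f_G := νQv(K₀)⁻¹𝟙_{K₀} + νQv(K₁)⁻¹𝟙_{K₁} − νQv(I)⁻¹𝟙_I` for the two (special) vertex stabilisers `K₀, K₁` and the Iwahori `I = K₀ ⊓ K₁` of the
`(q+1)`-regular lattice tree of `U(3)` at `w`, pulled back along ★ `localNonsplitEquiv` — measurable, integrable, of MASS ONE, with `f_G(1)` REAL NEGATIVE, canonical orbital integral `1`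
at every regular class with COMPACT centraliser and `0` at every regular class with NON-compact centraliser.  SAME conclusion shape as ★ (G3) (eight clauses, in order), so the
★ (G4)∕(G5) consumers `obtain` it identically at a tame ramified place.

HOW (re-lettering of ★ (G3), row by row).  Tame block `(ϖ, |ϖ| = exp(−1), σ_w ϖ = −ϖ, hres, hnorm)` from ★ `ramifiedBlock_adicCompletion (he) (h2w)`; (E) `hE` := ★ EULER-G-RAM
`natCard_fixedBy_add_eq_natCard_fixedBy_inf_add_one_three_of_neg`; (N) `hN` := §2 `epNonEllipticCombination_eq_zero_three_of_neg` (the CM head of ★ P3 re-lettered over ★ C₃-RAM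
`epCombination_classOrbitalIntegral_eq_zero_of_latticeModel_three_of_neg`, translation `e τ = diag(ϖ⁻¹, 1, σ_w ϖ)`), with (T1) := §0 (★ (G3) §0 with the uniformiser of `L_w` in place
of `ι_w ϖ_v` — at a ramified `w`, `|ι_w ϖ_v| = |ϖ|²`) and (T2) := ★ (T2)-RAM `exists_splitTorus_generator_local_of_nonsplit_three_of_involution`; value at one: ★ (G0)-RAM indices
`[K₀ : I] = [K₁ : I] = q + 1` (`index_inf_subgroupOf_eq_of_ramified`, `q = |𝓀_w|`) + ★ `measureReal_coe_eq_index_mul` + §1 `epValueAtOne_neg_of_ramified`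
(`νQv(K₀)⁻¹ + νQv(K₁)⁻¹ − νQv(I)⁻¹ = νQv(I)⁻¹(2∕(q+1) − 1) < 0` since `q ≥ 2`); ★ GLUE `…_of_relations_congr'` and ★ `classOrbitalIntegral_epCombination_eq(_of_compactSpace)` unchanged.

* §0 `exists_conj_coe_localNonsplitEquiv_eq_diagonal_of_not_isCompact_centralizer_of_v` — (T1) for ANY `ϖ ∈ L_w` with `|ϖ| = exp(−1)` (no `hunr`).
* §1 `epValueAtOne_neg_of_ramified` — the sign of `a⁻¹ + b⁻¹ − m⁻¹` for `a = b = (q+1)·m`, `q ≥ 2` (the `(q+1, q+1)` twin of ★ (G7) `epValueAtOne_eq_and_neg`).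
* §2 `epNonEllipticCombination_eq_zero_three_of_neg` — the CM (N)-RAM head (★ P3's CM head with `hd ↦` tame block, `hτm` third slot `σ_w ϖ`).
* §3 (FILE B `F0P3cStCharTSEPGlueGRamified`) **`exists_epFunction_G_of_ramified`** — the head.
HONEST LABEL: count-neutral helper (UNPROVED 16 unchanged; it widens the EP-G column — K1∕K2′∕POS-ONE instances at `St(ψ)`∕`ψ∘det` — to TAME RAMIFIED places, instances only at t1′;
WILD∕dyadic ramified places stay OPEN, census G-RAM §4); h413 OPEN; HC_CM is proved only modulo the 7 printed citations (2 remaining named inputs: hLiu418 =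
`stmt-HodgeConjecture-24832`, h413 = `stmt-HodgeConjecture-24833`) until rung 0 closes.

## References
* [Kottwitz1988] R. E. Kottwitz, *Tamagawa numbers*, Ann. of Math. 127 (1988), §2 Theorem 2 (Euler–Poincaré functions on a rank-one group; `Φ(γ, f_EP) = χ(𝒯^γ)`).
* [Rogawski1990] J. D. Rogawski, *Automorphic Representations of Unitary Groups in Three Variables* (1990), §12.6 p. 187 (pseudo-coefficients), §12.3 p. 176, §3.6 pp. 28–31.
* [Tits1979] J. Tits, *Reductive groups over local fields*, PSPM 33.1 (1979), §2.4 (local index `(q+1, q+1)` of the ramified `²A₂`), §3.5, §3.9.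
* [Serre1980Trees] J.-P. Serre, *Trees* (1980), II.1.1–1.3.
* [Laumon1995] G. Laumon, *Cohomology of Drinfeld Modular Varieties* I (1996), Lemma (5.3.2) p. 136.
-/

set_option autoImplicit false
-- the mandated namespace has the single-problem summit's repeated segment (`HodgeConjecture.HodgeConjecture`)
set_option linter.dupNamespace false

noncomputable section

open NumberField IsDedekindDomain MeasureTheory Topology
open scoped Matrix MatrixGroups Valued
open Literature.NumberTheory.Rogawski1990 Literature.NumberTheory.Automorphic Literature.NumberTheory.Automorphic.UnitaryGroup
open Literature.NumberTheory.GaloisRepresentations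
open Summit.HodgeConjecture.HodgeConjecture.Cruxes.H413.F0P3cStCharTSTorusDefs
open Summit.HodgeConjecture.HodgeConjecture.Cruxes.H413.F0P3cStCharTSEPGlueG

namespace Summit.HodgeConjecture.HodgeConjecture.Cruxes.H413.F0P3cStCharTSEPGlueGRamified

variable (L : Type) [Field L] [NumberField L] [IsCMField L] (v : HeightOneSpectrum (𝓞 ↥(maximalRealSubfield L)))

/-! ## §0 (T1) at an arbitrary uniformiser of `L_w`: regular elements with non-compact centraliser are conjugate into the diagonal torus -/

set_option maxHeartbeats 400000 in  -- ED. 2 (budget line only, 0 statement∕proof bytes moved): measured 2026-09-03 — the body (★ (G3) §0's, two lines lighter) times out at `whnf` under 160000 and passes under the default 200000, i.e. < 20 % headroom; same cliff and same budget as ★ (G3) §0 ED. 2 p853091 (director s1655 ∕ LEAD T15-19 RULE 24)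
/-- **(T1)** — a REGULAR `γ ∈ U(Φ₃)(L⁺_v)` (`v` non-split) whose centraliser is NOT compact is conjugate (`IsConj γ γ′`) to an element `γ′` whose one-place image `e γ′ ∈ U(σ_w, (Φ₃)_w)(L_w)` is a
REGULAR DIAGONAL matrix `diagonal d` with `|d 0|_w = |ϖ|^c`, `|d 1|_w = 1`, `|d 2|_w = |ϖ|^(−c)` for ANY `ϖ ∈ L_w` with `|ϖ|_w = exp(−1)` (a uniformiser of `L_w` — at a ramified `w` NOT `ι_w ϖ_v`) and some `c ∈ ℤ` (★ `isCompact_centralizer_iff_not_mem_hyperbolicSet`: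
`γ ∈ Ω` = conjugate of a regular diagonal-torus element; ★ `localNonsplitEquiv_apply_apply`; the torus relations `σ_w(d₀)·d₂ = 1`, `σ_w(d₁)·d₁ = 1`).
[cite: Rogawski1990, §3.6 pp. 28–31; §12.5 p. 182] [cite: Tits1979, §1.2 pp. 31–32; §1.15 p. 40] -/
theorem exists_conj_coe_localNonsplitEquiv_eq_diagonal_of_not_isCompact_centralizer_of_v
    (hns : ∀ w : PlacesOver L v, IsCMField.complexConj L • w.1 = w.1)
    (w : PlacesOver L v) (hw : IsCMField.complexConj L • w.1 = w.1) {ϖ : w.1.adicCompletion L} (hvϖ : Valued.v ϖ = WithZero.exp (-1 : ℤ))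
    {γ : Gqs L v} (hreg : IsRegularElt (γ.val : GL (Fin 3) (UnitaryGroup.LocalRing L v)))
    (hnc : ¬ IsCompact ((Subgroup.centralizer ({γ} : Set (Gqs L v))) : Set (Gqs L v))) :
    ∃ (γ' : Gqs L v) (d : Fin 3 → w.1.adicCompletion L) (c : ℤ), IsConj γ γ' ∧
      (((localNonsplitEquiv (IsCMField.complexConj L) (qsForm L) (IsCMField.complexConj_ne_one L) w hw γ' :
          ↥(unitaryGroupOfForm (galAdicCompletionMap (L := L) (IsCMField.complexConj L) hw) (placeForm (qsForm L) w.1))) :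
            GL (Fin 3) (w.1.adicCompletion L)) : Matrix (Fin 3) (Fin 3) (w.1.adicCompletion L)) = Matrix.diagonal d ∧
      (∀ i j : Fin 3, i ≠ j → IsUnit (d i - d j)) ∧
      Valued.v (d 0) = Valued.v (ϖ ^ c) ∧
      Valued.v (d 1) = 1 ∧
      Valued.v (d 2) = Valued.v (ϖ ^ (-c)) := by
  set σ := galAdicCompletionMap (L := L) (IsCMField.complexConj L) hw with hσdef
  set eU := localNonsplitEquiv (IsCMField.complexConj L) (qsForm L) (IsCMField.complexConj_ne_one L) w hw with heUdef
  -- `γ` is hyperbolic: conjugate to a regular diagonal-torus element `t`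
  have hΩ : γ ∈ hyperbolicSet L v := by
    by_contra hΩ
    exact hnc ((F0P3cStCharTSEllCartanCompact.isCompact_centralizer_iff_not_mem_hyperbolicSet L v hns hreg).2 hΩ)
  obtain ⟨t, htreg, htconj⟩ := hΩ
  -- the diagonal entries of `t`, read at `w`
  obtain ⟨dU, hdU⟩ := (mem_torusU_iff (σ := conjLocal L (IsCMField.complexConj L) v) (J := cmLocalForm L 3 v)
    (t : ↥(unitaryGroupOfForm (conjLocal L (IsCMField.complexConj L) v) (cmLocalForm L 3 v)))).1 t.2
  set d : Fin 3 → w.1.adicCompletion L := fun i => ((dU i : LocalRing L v)) w with hddef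
  have heUt : (((eU ((t : ↥(unitaryGroupOfForm (conjLocal L (IsCMField.complexConj L) v) (cmLocalForm L 3 v))) : Gqs L v) :
      ↥(unitaryGroupOfForm σ (placeForm (qsForm L) w.1))) : GL (Fin 3) (w.1.adicCompletion L)) : Matrix (Fin 3) (Fin 3) (w.1.adicCompletion L)) =
      Matrix.diagonal d := by
    rw [heUdef, coe_localNonsplitEquiv_apply L (qsForm L) v w hw]
    change (((t : ↥(unitaryGroupOfForm (conjLocal L (IsCMField.complexConj L) v) (cmLocalForm L 3 v))) : GL (Fin 3) (LocalRing L v)) :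
        Matrix (Fin 3) (Fin 3) (LocalRing L v)).map (Pi.evalRingHom (fun w' : PlacesOver L v => w'.1.adicCompletion L) w) = Matrix.diagonal d
    rw [← hdU, coe_glDiagonal, Matrix.diagonal_map (map_zero _)]
    rfl
  -- regularity of `d`
  have hsep : (Matrix.diagonal d).charpoly.Separable := by
    rw [← heUt]
    exact (TypeThreeTorus.isRegularElt_iff_separable_localNonsplitEquiv L w hw _).1 htreg
  have hinj : Function.Injective d := by
    rw [Matrix.charpoly_diagonal] at hsep
    exact Polynomial.separable_prod_X_sub_C_iff.1 hsep
  have hdreg : ∀ i j : Fin 3, i ≠ j → IsUnit (d i - d j) := fun i j hij =>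
    isUnit_iff_ne_zero.2 (sub_ne_zero.2 fun h => hij (hinj h))
  -- the torus relations at `w`: `σ_w(d₀)·d₂ = 1`, `σ_w(d₁)·d₁ = 1`
  have hform := TypeThreeTorus.placeForm_qsForm_eq L w
  have hH₀₂ : placeForm (qsForm L) w.1 0 2 ≠ 0 := by rw [hform]; exact one_ne_zero
  have hH₁₁ : placeForm (qsForm L) w.1 1 1 ≠ 0 := by rw [hform]; exact one_ne_zero
  have hmem := (eU ((t : ↥(unitaryGroupOfForm (conjLocal L (IsCMField.complexConj L) v) (cmLocalForm L 3 v))) : Gqs L v)).2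
  have h02 : σ (d 0) * d 2 = 1 := map_apply_zero_mul_apply_two_eq_one_of_mem_unitaryGroupOfForm σ hH₀₂ hmem heUt
  have h11 : σ (d 1) * d 1 = 1 := map_apply_one_mul_apply_one_eq_one_of_mem_unitaryGroupOfForm σ hH₁₁ hmem heUt
  have hσv : ∀ y : w.1.adicCompletion L, Valued.v (σ y) = Valued.v y := fun y => valued_galAdicCompletionMap (L := L) (IsCMField.complexConj L) hw y
  have hv1 : Valued.v (d 1) = 1 := by
    have h := congrArg Valued.v h11
    rw [map_mul, map_one, hσv, ← pow_two] at h
    exact (pow_eq_one_iff.1 h).resolve_right two_ne_zero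
  have hv02 : Valued.v (d 0) * Valued.v (d 2) = 1 := by
    have h := congrArg Valued.v h02
    rwa [map_mul, map_one, hσv] at h
  have hd0 : d 0 ≠ 0 := fun h0 => by rw [h0, map_zero, zero_mul] at hv02; exact zero_ne_one hv02
  have hvd0 : Valued.v (d 0) ≠ 0 := (Valuation.ne_zero_iff _).2 hd0
  -- `|d₀| = |ϖ|^c` with `c := −log|d₀|`
  set m : ℤ := WithZero.log (Valued.v (d 0)) with hmdef
  have hvd0' : Valued.v (d 0) = WithZero.exp m := by rw [hmdef, WithZero.exp_log hvd0]
  refine ⟨((t : ↥(unitaryGroupOfForm (conjLocal L (IsCMField.complexConj L) v) (cmLocalForm L 3 v))) : Gqs L v), d, -m, htconj.symm, heUt, hdreg, ?_, hv1, ?_⟩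
  · rw [map_zpow₀, hvϖ, ← WithZero.exp_zsmul, hvd0']
    congr 1; simp only [smul_eq_mul]; ring
  · rw [map_zpow₀, hvϖ, ← WithZero.exp_zsmul, eq_inv_of_mul_eq_one_right hv02, hvd0', ← WithZero.exp_neg]
    congr 1; simp only [smul_eq_mul]; ring

/-! ## §1 (G3) Kottwitz's Euler–Poincaré function on `U(Φ₃)(L⁺_v)` -/

/-! ## §1 The sign of Kottwitz's `f_EP(1)` from the tame-ramified indices `(q+1, q+1)` -/

/-- **`μ(K₀)⁻¹ + μ(K₁)⁻¹ − μ(I)⁻¹ < 0` when `μ(K₀) = μ(K₁) = (q+1)·μ(I)`, `μ(I) > 0`, `q ≥ 2`**: the value is `μ(I)⁻¹ · (2∕(q+1) − 1)` and `2∕(q+1) ≤ 2∕3 < 1` — Kottwitz's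
`f_EP^G(1) < 0` for the ramified quasi-split `U(3)` (both vertices of local index `q+1`); the `(q³+1, q+1)` unramified twin is ★ `UnitaryLatticeTree.epValueAtOne_eq_and_neg`.
[cite: Kottwitz1988, §2] [cite: Tits1979, §2.4] -/
theorem epValueAtOne_neg_of_ramified {m : ℝ} (hm : 0 < m) {q : ℕ} (hq : 2 ≤ q) {a b : ℝ} (ha : a = ((q : ℝ) + 1) * m) (hb : b = ((q : ℝ) + 1) * m) :
    a⁻¹ + b⁻¹ - m⁻¹ < 0 := by
  have hq1 : (0 : ℝ) < (q : ℝ) + 1 := by positivity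
  have hq2 : (2 : ℝ) ≤ (q : ℝ) := by exact_mod_cast hq
  rw [ha, hb]
  have hkey : (((q : ℝ) + 1) * m)⁻¹ + (((q : ℝ) + 1) * m)⁻¹ - m⁻¹ = m⁻¹ * ((2 - ((q : ℝ) + 1)) / ((q : ℝ) + 1)) := by
    field_simp
    ring
  rw [hkey]
  exact mul_neg_of_pos_of_neg (inv_pos.2 hm) (div_neg_of_neg_of_pos (by linarith) hq1)

/-! ## §2 The CM (N)-relation at a tame ramified place (★ P3's CM head re-lettered over ★ C₃-RAM) -/

section CoreRamified

open Matrix MeasureTheory.Measure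

variable {v}
variable (w : PlacesOver L v) (hw : IsCMField.complexConj L • w.1 = w.1)
  [MeasurableSpace ((cmDatum L 3 (Matrix.of fun i j : Fin 3 => if i.val + j.val + 1 = 3 then (1 : L) else 0)).Local v)] [BorelSpace ((cmDatum L 3 (Matrix.of fun i j : Fin 3 => if i.val + j.val + 1 = 3 then (1 : L) else 0)).Local v)]
  [∀ γ : (cmDatum L 3 (Matrix.of fun i j : Fin 3 => if i.val + j.val + 1 = 3 then (1 : L) else 0)).Local v,
    MeasurableSpace (((cmDatum L 3 (Matrix.of fun i j : Fin 3 => if i.val + j.val + 1 = 3 then (1 : L) else 0)).Local v) ⧸ Subgroup.centralizer ({γ} : Set ((cmDatum L 3 (Matrix.of fun i j : Fin 3 => if i.val + j.val + 1 = 3 then (1 : L) else 0)).Local v)))]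
  [∀ γ : (cmDatum L 3 (Matrix.of fun i j : Fin 3 => if i.val + j.val + 1 = 3 then (1 : L) else 0)).Local v,
    BorelSpace (((cmDatum L 3 (Matrix.of fun i j : Fin 3 => if i.val + j.val + 1 = 3 then (1 : L) else 0)).Local v) ⧸ Subgroup.centralizer ({γ} : Set ((cmDatum L 3 (Matrix.of fun i j : Fin 3 => if i.val + j.val + 1 = 3 then (1 : L) else 0)).Local v)))]
  (ν : Measure ((cmDatum L 3 (Matrix.of fun i j : Fin 3 => if i.val + j.val + 1 = 3 then (1 : L) else 0)).Local v)) [IsHaarMeasure ν] [ν.IsMulRightInvariant]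

set_option maxHeartbeats 800000 in
-- as ★ P3's CM head `epNonEllipticCombination_eq_zero_three` (measured there): the closing `exact` of the generic ★ C₃-RAM theorem over the CM carrier needs > 200000 at `whnf`
include hw in
/-- **KOTTWITZ'S NON-ELLIPTIC RELATION FOR `f_EP` OF THE QUASI-SPLIT `U(3)` AT A TAME RAMIFIED PLACE, with the split-torus kit as binders** — ★ P3's CM head
`epNonEllipticCombination_eq_zero_three` with its datum `hd` replaced by the tame block `(|ϖ| = exp(−1), σ_w ϖ = −ϖ, hres, |2|_w = 1, hnorm)` and the translation `e τ = diag(ϖ⁻¹, 1, σ_w ϖ)`;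
body = ★ C₃-RAM `epCombination_classOrbitalIntegral_eq_zero_of_latticeModel_three_of_neg` BY NAME at `eU := localNonsplitEquiv`.  Conclusion = the `hN` binder of ★
`RankOneEulerPoincareGlue.exists_isLocSmooth_classOrbitalIntegral_eq_one_zero_of_relations` at `(Kv, Ke, I)`, token for token as ★ P3.
[cite: Kottwitz1988, §2 Theorem 2] [cite: Serre1980Trees, I.6.4; II.1.1] [cite: Laumon1995, Lemma (5.3.2) p. 136] [cite: Rogawski1990, §12.3 p. 176; §3.6 pp. 28–29] [cite: Tits1979, §2.4, §3.5] -/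
theorem epNonEllipticCombination_eq_zero_three_of_neg
    {m : OrbitalMeasureFamily ((cmDatum L 3 (Matrix.of fun i j : Fin 3 => if i.val + j.val + 1 = 3 then (1 : L) else 0)).Local v)}
    (hm : m.IsCanonical (fun γ => IsRegularElt (γ.val : GL (Fin 3) (UnitaryGroup.LocalRing L v))) ν)
    {ϖ : w.1.adicCompletion L} (hϖ : Valued.v ϖ = WithZero.exp (-1 : ℤ)) (hσϖ : galAdicCompletionMap (L := L) (IsCMField.complexConj L) hw ϖ = -ϖ)
    (hres : ∀ x : w.1.adicCompletion L, Valued.v x ≤ 1 → Valued.v (galAdicCompletionMap (L := L) (IsCMField.complexConj L) hw x - x) < 1)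
    (h2 : Valued.v (2 : w.1.adicCompletion L) = 1)
    (hnorm : ∀ u : w.1.adicCompletion L, galAdicCompletionMap (L := L) (IsCMField.complexConj L) hw u = u → Valued.v (u - 1) < 1 →
      ∃ z : w.1.adicCompletion L, z * galAdicCompletionMap (L := L) (IsCMField.complexConj L) hw z = u ∧ Valued.v (z - 1) ≤ Valued.v (u - 1))
    (g₁ : GL (Fin 3) (w.1.adicCompletion L)) (hg₁ : (g₁ : Matrix (Fin 3) (Fin 3) (w.1.adicCompletion L)) = diagonal ![(1 : w.1.adicCompletion L), 1, ϖ])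
    (Kv Ke I : Subgroup ((cmDatum L 3 (Matrix.of fun i j : Fin 3 => if i.val + j.val + 1 = 3 then (1 : L) else 0)).Local v))
    (hKv : ∀ g : (cmDatum L 3 (Matrix.of fun i j : Fin 3 => if i.val + j.val + 1 = 3 then (1 : L) else 0)).Local v,
      g ∈ Kv ↔ (((localNonsplitEquiv (IsCMField.complexConj L) (Matrix.of fun i j : Fin 3 => if i.val + j.val + 1 = 3 then (1 : L) else 0)
          (IsCMField.complexConj_ne_one L) w hw) g : ↥(unitaryGroupOfForm (galAdicCompletionMap (L := L) (IsCMField.complexConj L) hw)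
            (placeForm (Matrix.of fun i j : Fin 3 => if i.val + j.val + 1 = 3 then (1 : L) else 0) w.1))) : GL (Fin 3) (w.1.adicCompletion L)) ∈ glInt 3 (w.1.adicCompletion L))
    (hKe : ∀ g : (cmDatum L 3 (Matrix.of fun i j : Fin 3 => if i.val + j.val + 1 = 3 then (1 : L) else 0)).Local v,
      g ∈ Ke ↔ (((localNonsplitEquiv (IsCMField.complexConj L) (Matrix.of fun i j : Fin 3 => if i.val + j.val + 1 = 3 then (1 : L) else 0)
          (IsCMField.complexConj_ne_one L) w hw) g : ↥(unitaryGroupOfForm (galAdicCompletionMap (L := L) (IsCMField.complexConj L) hw)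
            (placeForm (Matrix.of fun i j : Fin 3 => if i.val + j.val + 1 = 3 then (1 : L) else 0) w.1))) : GL (Fin 3) (w.1.adicCompletion L)) ∈
        (glInt 3 (w.1.adicCompletion L)).map (MulAut.conj g₁).toMonoidHom)
    (hI : ∀ g : (cmDatum L 3 (Matrix.of fun i j : Fin 3 => if i.val + j.val + 1 = 3 then (1 : L) else 0)).Local v,
      g ∈ I ↔ (((localNonsplitEquiv (IsCMField.complexConj L) (Matrix.of fun i j : Fin 3 => if i.val + j.val + 1 = 3 then (1 : L) else 0)
          (IsCMField.complexConj_ne_one L) w hw) g : ↥(unitaryGroupOfForm (galAdicCompletionMap (L := L) (IsCMField.complexConj L) hw)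
            (placeForm (Matrix.of fun i j : Fin 3 => if i.val + j.val + 1 = 3 then (1 : L) else 0) w.1))) : GL (Fin 3) (w.1.adicCompletion L)) ∈ glInt 3 (w.1.adicCompletion L) ∧
        (((localNonsplitEquiv (IsCMField.complexConj L) (Matrix.of fun i j : Fin 3 => if i.val + j.val + 1 = 3 then (1 : L) else 0)
          (IsCMField.complexConj_ne_one L) w hw) g : ↥(unitaryGroupOfForm (galAdicCompletionMap (L := L) (IsCMField.complexConj L) hw)
            (placeForm (Matrix.of fun i j : Fin 3 => if i.val + j.val + 1 = 3 then (1 : L) else 0) w.1))) : GL (Fin 3) (w.1.adicCompletion L)) ∈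
          (glInt 3 (w.1.adicCompletion L)).map (MulAut.conj g₁).toMonoidHom)
    (hKvo : IsOpen (Kv : Set ((cmDatum L 3 (Matrix.of fun i j : Fin 3 => if i.val + j.val + 1 = 3 then (1 : L) else 0)).Local v))) (hKvc : IsCompact (Kv : Set ((cmDatum L 3 (Matrix.of fun i j : Fin 3 => if i.val + j.val + 1 = 3 then (1 : L) else 0)).Local v)))
    (hKeo : IsOpen (Ke : Set ((cmDatum L 3 (Matrix.of fun i j : Fin 3 => if i.val + j.val + 1 = 3 then (1 : L) else 0)).Local v))) (hKec : IsCompact (Ke : Set ((cmDatum L 3 (Matrix.of fun i j : Fin 3 => if i.val + j.val + 1 = 3 then (1 : L) else 0)).Local v)))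
    (hIo : IsOpen (I : Set ((cmDatum L 3 (Matrix.of fun i j : Fin 3 => if i.val + j.val + 1 = 3 then (1 : L) else 0)).Local v))) (hIc : IsCompact (I : Set ((cmDatum L 3 (Matrix.of fun i j : Fin 3 => if i.val + j.val + 1 = 3 then (1 : L) else 0)).Local v)))
    (hT1 : ∀ γ : (cmDatum L 3 (Matrix.of fun i j : Fin 3 => if i.val + j.val + 1 = 3 then (1 : L) else 0)).Local v,
      IsRegularElt (γ.val : GL (Fin 3) (UnitaryGroup.LocalRing L v)) →
      ¬ CompactSpace (Subgroup.centralizer ({γ} : Set ((cmDatum L 3 (Matrix.of fun i j : Fin 3 => if i.val + j.val + 1 = 3 then (1 : L) else 0)).Local v))) →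
      ∃ (g : (cmDatum L 3 (Matrix.of fun i j : Fin 3 => if i.val + j.val + 1 = 3 then (1 : L) else 0)).Local v) (e : Fin 3 → w.1.adicCompletion L) (c : ℤ),
        ((((localNonsplitEquiv (IsCMField.complexConj L) (Matrix.of fun i j : Fin 3 => if i.val + j.val + 1 = 3 then (1 : L) else 0)
          (IsCMField.complexConj_ne_one L) w hw) (g * γ * g⁻¹) : ↥(unitaryGroupOfForm (galAdicCompletionMap (L := L) (IsCMField.complexConj L) hw)
            (placeForm (Matrix.of fun i j : Fin 3 => if i.val + j.val + 1 = 3 then (1 : L) else 0) w.1))) : GL (Fin 3) (w.1.adicCompletion L)) : Matrix (Fin 3) (Fin 3) (w.1.adicCompletion L)) =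
          diagonal e ∧
        Valued.v (e 0) = Valued.v (ϖ ^ c) ∧ Valued.v (e 1) = 1 ∧ Valued.v (e 2) = Valued.v (ϖ ^ (-c)))
    (hT2 : ∀ δ : (cmDatum L 3 (Matrix.of fun i j : Fin 3 => if i.val + j.val + 1 = 3 then (1 : L) else 0)).Local v,
      IsRegularElt (δ.val : GL (Fin 3) (UnitaryGroup.LocalRing L v)) →
      (∃ e : Fin 3 → w.1.adicCompletion L,
        ((((localNonsplitEquiv (IsCMField.complexConj L) (Matrix.of fun i j : Fin 3 => if i.val + j.val + 1 = 3 then (1 : L) else 0)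
          (IsCMField.complexConj_ne_one L) w hw) δ : ↥(unitaryGroupOfForm (galAdicCompletionMap (L := L) (IsCMField.complexConj L) hw)
            (placeForm (Matrix.of fun i j : Fin 3 => if i.val + j.val + 1 = 3 then (1 : L) else 0) w.1))) : GL (Fin 3) (w.1.adicCompletion L)) : Matrix (Fin 3) (Fin 3) (w.1.adicCompletion L)) =
          diagonal e) →
      ∃ τ : Subgroup.centralizer ({δ} : Set ((cmDatum L 3 (Matrix.of fun i j : Fin 3 => if i.val + j.val + 1 = 3 then (1 : L) else 0)).Local v)),
        ((((localNonsplitEquiv (IsCMField.complexConj L) (Matrix.of fun i j : Fin 3 => if i.val + j.val + 1 = 3 then (1 : L) else 0)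
          (IsCMField.complexConj_ne_one L) w hw) (τ : (cmDatum L 3 (Matrix.of fun i j : Fin 3 => if i.val + j.val + 1 = 3 then (1 : L) else 0)).Local v) :
            ↥(unitaryGroupOfForm (galAdicCompletionMap (L := L) (IsCMField.complexConj L) hw)
            (placeForm (Matrix.of fun i j : Fin 3 => if i.val + j.val + 1 = 3 then (1 : L) else 0) w.1))) : GL (Fin 3) (w.1.adicCompletion L)) : Matrix (Fin 3) (Fin 3) (w.1.adicCompletion L)) =
          diagonal ![ϖ⁻¹, 1, galAdicCompletionMap (L := L) (IsCMField.complexConj L) hw ϖ] ∧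
        (∀ c' : Subgroup.centralizer ({δ} : Set ((cmDatum L 3 (Matrix.of fun i j : Fin 3 => if i.val + j.val + 1 = 3 then (1 : L) else 0)).Local v)), ∃ n : ℤ,
          c' * (τ ^ n)⁻¹ ∈ compactCore (Subgroup.centralizer ({δ} : Set ((cmDatum L 3 (Matrix.of fun i j : Fin 3 => if i.val + j.val + 1 = 3 then (1 : L) else 0)).Local v)))) ∧
        (∀ n : ℤ, τ ^ n ∈ compactCore (Subgroup.centralizer ({δ} : Set ((cmDatum L 3 (Matrix.of fun i j : Fin 3 => if i.val + j.val + 1 = 3 then (1 : L) else 0)).Local v))) → n = 0))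
    (γ : (cmDatum L 3 (Matrix.of fun i j : Fin 3 => if i.val + j.val + 1 = 3 then (1 : L) else 0)).Local v) (hreg : IsRegularElt (γ.val : GL (Fin 3) (UnitaryGroup.LocalRing L v)))
    (hnc : ¬ CompactSpace (Subgroup.centralizer ({γ} : Set ((cmDatum L 3 (Matrix.of fun i j : Fin 3 => if i.val + j.val + 1 = 3 then (1 : L) else 0)).Local v)))) :
    (((ν Kv).toReal : ℂ))⁻¹ * classOrbitalIntegral m ((Kv : Set ((cmDatum L 3 (Matrix.of fun i j : Fin 3 => if i.val + j.val + 1 = 3 then (1 : L) else 0)).Local v)).indicator fun _ => (1 : ℂ)) (ConjClasses.mk γ) +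
        (((ν Ke).toReal : ℂ))⁻¹ * classOrbitalIntegral m ((Ke : Set ((cmDatum L 3 (Matrix.of fun i j : Fin 3 => if i.val + j.val + 1 = 3 then (1 : L) else 0)).Local v)).indicator fun _ => (1 : ℂ)) (ConjClasses.mk γ) -
        (((ν I).toReal : ℂ))⁻¹ * classOrbitalIntegral m ((I : Set ((cmDatum L 3 (Matrix.of fun i j : Fin 3 => if i.val + j.val + 1 = 3 then (1 : L) else 0)).Local v)).indicator fun _ => (1 : ℂ)) (ConjClasses.mk γ) = 0 := by
  have hc1 : IsCMField.complexConj L ≠ 1 := IsCMField.complexConj_ne_one L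
  -- names for the one-place data
  set E := w.1.adicCompletion L with hEdef
  set σ : E →+* E := galAdicCompletionMap (L := L) (IsCMField.complexConj L) hw with hσdef
  set eW := (localNonsplitEquiv (IsCMField.complexConj L) (Matrix.of fun i j : Fin 3 => if i.val + j.val + 1 = 3 then (1 : L) else 0)
          (IsCMField.complexConj_ne_one L) w hw) with heW
  -- `IsRegularElt` is a class function on `U₃`
  have hP : ∀ g x : (cmDatum L 3 (Matrix.of fun i j : Fin 3 => if i.val + j.val + 1 = 3 then (1 : L) else 0)).Local v, IsRegularElt (g.val : GL (Fin 3) (UnitaryGroup.LocalRing L v)) →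
      IsRegularElt ((x * g * x⁻¹).val : GL (Fin 3) (UnitaryGroup.LocalRing L v)) := fun g x hg => isRegularElt_val_conj L 3 _ v g x hg
  -- (T1): a regular DIAGONAL representative `δ` of the class of `γ`, with valuation profile `(|ϖ^c|, 1, |ϖ^{−c}|)`
  obtain ⟨g, e, c, hδm, he₀, he₁, he₂⟩ := hT1 γ hreg hnc
  have hcl : ConjClasses.mk (g * γ * g⁻¹) = ConjClasses.mk γ := ConjClasses.mk_eq_mk_iff_isConj.2 (isConj_iff.2 ⟨g, rfl⟩).symm
  rw [← hcl]
  set δ : (cmDatum L 3 (Matrix.of fun i j : Fin 3 => if i.val + j.val + 1 = 3 then (1 : L) else 0)).Local v := g * γ * g⁻¹ with hδdef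
  have hregδ : IsRegularElt (δ.val : GL (Fin 3) (UnitaryGroup.LocalRing L v)) := isRegularElt_val_conj L 3 _ v γ g hreg
  -- (T2): the split-torus generator `τ ∈ Z(δ)` with (gen), (free)
  obtain ⟨τ, hτm, hgen, hfree⟩ := hT2 δ hregδ ⟨e, hδm⟩
  -- the compact-core facts, the closed class
  obtain ⟨hcomm, hcc, hco⟩ := compactCore_centralizer_local_facts_of_isRegularElt (IsCMField.complexConj L) 3 _ hc1
    (UnitaryGroup.antidiagOne_map_transpose (IsCMField.complexConj L) 3) (isUnit_antidiagOne_det L 3) δ hregδ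
  have hO := isClosed_conjClass_local_of_isRegularElt L 3 (Matrix.of fun i j : Fin 3 => if i.val + j.val + 1 = 3 then (1 : L) else 0) v
    (antidiagOne_isHermitian L 3) (isUnit_antidiagOne_det L 3).ne_zero δ hregδ
  -- ★ THEOREM C₃ at `δ` on the one-place model `e_w` (the `J₀`-spelling cast `placeForm Φ₃ w = (StdForm.antidiagonal 3).over E` is a `subst` inside)
  have hσσ : ∀ x : w.1.adicCompletion L, σ (σ x) = x := galAdicCompletionMap_galAdicCompletionMap_of_smul_eq (IsCMField.complexConj L) w hc1 hw
  have hvσ : ∀ x : w.1.adicCompletion L, Valued.v (σ x) = Valued.v x := fun x => valued_galAdicCompletionMap (L := L) (IsCMField.complexConj L) hw x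
  exact epCombination_classOrbitalIntegral_eq_zero_of_latticeModel_three_of_neg hP hm hσσ hvσ hϖ hσϖ hres h2 hnorm g₁ hg₁ (placeForm_antidiagThree_eq_over L w) eW.toMulEquiv Kv Ke I
    hKv hKe hI hKvo hKvc hKeo hKec hIo hIc hregδ hO hcomm hcc hco τ hgen hfree hτm hδm he₀ he₁ he₂

end CoreRamified

end Summit.HodgeConjecture.HodgeConjecture.Cruxes.H413.F0P3cStCharTSEPGlueGRamified

end
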